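import Summits.AnomalousDissipation.AnomalousDissipation.Theorems.MomentParityQuarticGateCoords

/-!
# Budget polynomials (infrastructure I5 for `MomentParity.QuarticGate`, line `recession-cone`,
stmt-AnomalousDissipation-11464)

In an orthonormal band basis `b` of `V_N` (bundle `hb`, `hbo`, `hbs`) the two budgets of the crux are
QUADRATIC polynomials of the coordinates `xᵢ = (u, bᵢ)` of a level-`N` field:

* energy: `‖u‖² = Σᵢ xᵢ²` (`norm_sq_eq_sum_sq_coords`, file `…Coords`), hence
  `ensembleEnergy μ = ∫ Σᵢ xᵢ² dμ` for a level-`N`-carried law (`ensembleEnergy_eq_integral_sum_sq`);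
* dissipation: `‖∇u‖² = D(x)` with the homogeneous quadratic `D = −Σⱼₖ Xⱼ Xₖ (bⱼ, Δbₖ)`
  (`exists_dissipationPoly`), hence `ensembleDissipation ν μ = ν ∫ D(x) dμ`
  (`ensembleDissipation_eq_integral_eval`).
-/

namespace Summit.AnomalousDissipation.AnomalousDissipation.Theorems.MomentParityQuarticGate

open MeasureTheory Filter MvPolynomial
open scoped InnerProductSpace RealInnerProductSpace ENNReal
open Literature.Analysis.FunctionSpaces Literature.Analysis.FluidPDE
open Summit.AnomalousDissipation.AnomalousDissipation.Theses.MomentParity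

set_option linter.dupNamespace false

variable {N n : ℕ} {b : Fin n → UnitAddTorus (Fin 3) → EuclideanSpace ℝ (Fin 3)}

/-- **The enstrophy of a level-`N` field in coordinates**:
`‖∇u‖² = −Σⱼ Σₖ xⱼ xₖ (bⱼ, Δbₖ)`. [folklore] -/
theorem toReal_eGradNormSq_eq_of_level
    (hb : ∀ i, Torus.IsSmooth (b i) ∧ Torus.IsDivFree (b i) ∧ Torus.HasZeroMean (b i) ∧
      ∀ k ∉ (Torus.freqBall N).erase (0 : Fin 3 → ℤ),
        UnitAddTorus.mFourierCoeff (EuclideanSpace.complexify ∘ (b i)) k = 0)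
    (hbs : ∀ u : Torus.energySpace (Fin 3),
      (∀ k ∉ (Torus.freqBall N).erase (0 : Fin 3 → ℤ),
        UnitAddTorus.mFourierCoeff (EuclideanSpace.complexify ∘
          (u.1 : UnitAddTorus (Fin 3) → EuclideanSpace ℝ (Fin 3))) k = 0) →
      ∀ x, Torus.fourierTruncate N (u.1 : UnitAddTorus (Fin 3) → EuclideanSpace ℝ (Fin 3)) x =
        ∑ i, Torus.pairing u.1 (b i) • b i x)
    (u : Torus.energySpace (Fin 3))
    (hu : ∀ k ∉ (Torus.freqBall N).erase (0 : Fin 3 → ℤ),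
      UnitAddTorus.mFourierCoeff (EuclideanSpace.complexify ∘
        (u.1 : UnitAddTorus (Fin 3) → EuclideanSpace ℝ (Fin 3))) k = 0) :
    (Torus.eGradNormSq (u.1 : UnitAddTorus (Fin 3) → EuclideanSpace ℝ (Fin 3))).toReal =
      -∑ j, ∑ k, Torus.pairing u.1 (b j) * (Torus.pairing u.1 (b k) *
        (∫ y, ⟪b j y, Torus.laplacian (b k) y⟫_ℝ)) := by
  have hae := coe_ae_eq_sum_of_level hbs u hu
  have hint : Integrable (u.1 : UnitAddTorus (Fin 3) → EuclideanSpace ℝ (Fin 3)) volume :=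
    (Lp.memLp u.1).integrable one_le_two
  have hP : Torus.fourierTruncate N (u.1 : UnitAddTorus (Fin 3) → EuclideanSpace ℝ (Fin 3)) =
      fun y => ∑ k, Torus.pairing u.1 (b k) • b k y := funext (hbs u hu)
  have hlap : ∀ y, Torus.laplacian (Torus.fourierTruncate N
      (u.1 : UnitAddTorus (Fin 3) → EuclideanSpace ℝ (Fin 3))) y =
        ∑ k, Torus.pairing u.1 (b k) • Torus.laplacian (b k) y := fun y => by
    rw [hP]
    exact Torus.laplacian_sum_smul Finset.univ _ (fun k _ => (hb k).1) y
  have hiL : ∀ j k, Integrable (fun y => ⟪b j y, Torus.laplacian (b k) y⟫_ℝ) volume := fun j k =>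
    Torus.integrable_inner_of_continuous (hb j).1.integrable (hb k).1.laplacian.continuous
  rw [← CubicParityLoud.Negative.eGradNormSq_fourierTruncate_of_isLevel hu,
    neg_eq_iff_eq_neg.1 (Torus.integral_inner_laplacian_fourierTruncate hint N).symm]
  congr 1
  calc ∫ y, ⟪(u.1 : UnitAddTorus (Fin 3) → EuclideanSpace ℝ (Fin 3)) y, Torus.laplacian
        (Torus.fourierTruncate N (u.1 : UnitAddTorus (Fin 3) → EuclideanSpace ℝ (Fin 3))) y⟫_ℝ
      = ∫ y, ⟪∑ j, Torus.pairing u.1 (b j) • b j y,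
          ∑ k, Torus.pairing u.1 (b k) • Torus.laplacian (b k) y⟫_ℝ := by
        refine integral_congr_ae ?_
        filter_upwards [hae] with y hy
        rw [hy, hlap y]
    _ = ∫ y, ∑ j, ∑ k, Torus.pairing u.1 (b j) * (Torus.pairing u.1 (b k) *
          ⟪b j y, Torus.laplacian (b k) y⟫_ℝ) := by
        refine integral_congr_ae (ae_of_all _ fun y => ?_)
        simp_rw [sum_inner, real_inner_smul_left, inner_sum, real_inner_smul_right, Finset.mul_sum]
    _ = ∑ j, ∑ k, Torus.pairing u.1 (b j) * (Torus.pairing u.1 (b k) *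
          (∫ y, ⟪b j y, Torus.laplacian (b k) y⟫_ℝ)) := by
        rw [integral_finsetSum _ fun j _ =>
          integrable_finsetSum _ fun k _ => ((hiL j k).const_mul _).const_mul _]
        refine Finset.sum_congr rfl fun j _ => ?_
        rw [integral_finsetSum _ fun k _ => ((hiL j k).const_mul _).const_mul _]
        refine Finset.sum_congr rfl fun k _ => ?_
        rw [integral_const_mul, integral_const_mul]

/-- **I5 — DISSIPATION POLYNOMIAL.** In an orthonormal band basis there is a homogeneous quadratic
polynomial `D` with `‖∇u‖² = D((u, bᵢ)ᵢ)` for every level-`N` field `u`. [folklore] -/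
theorem exists_dissipationPoly :
    ∀ {N n : ℕ} {b : Fin n → UnitAddTorus (Fin 3) → EuclideanSpace ℝ (Fin 3)},
      (∀ i, Torus.IsSmooth (b i) ∧ Torus.IsDivFree (b i) ∧ Torus.HasZeroMean (b i) ∧
        ∀ k ∉ (Torus.freqBall N).erase (0 : Fin 3 → ℤ),
          UnitAddTorus.mFourierCoeff (EuclideanSpace.complexify ∘ (b i)) k = 0) →
      (∀ i j, ∫ x, ⟪b i x, b j x⟫_ℝ = if i = j then (1 : ℝ) else 0) →
      (∀ u : Torus.energySpace (Fin 3),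
        (∀ k ∉ (Torus.freqBall N).erase (0 : Fin 3 → ℤ),
          UnitAddTorus.mFourierCoeff (EuclideanSpace.complexify ∘
            (u.1 : UnitAddTorus (Fin 3) → EuclideanSpace ℝ (Fin 3))) k = 0) →
        ∀ x, Torus.fourierTruncate N (u.1 : UnitAddTorus (Fin 3) → EuclideanSpace ℝ (Fin 3)) x =
          ∑ i, Torus.pairing u.1 (b i) • b i x) →
      ∃ D : MvPolynomial (Fin n) ℝ, D.IsHomogeneous 2 ∧
        ∀ u : Torus.energySpace (Fin 3), (∀ k ∉ (Torus.freqBall N).erase (0 : Fin 3 → ℤ),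
            UnitAddTorus.mFourierCoeff (EuclideanSpace.complexify ∘
              (u.1 : UnitAddTorus (Fin 3) → EuclideanSpace ℝ (Fin 3))) k = 0) →
          (Torus.eGradNormSq (u.1 : UnitAddTorus (Fin 3) → EuclideanSpace ℝ (Fin 3))).toReal =
            MvPolynomial.eval (fun i => Torus.pairing u.1 (b i)) D := by
  intro N n b hb _hbo hbs
  refine ⟨∑ j, ∑ k, X j * (X k * C (-(∫ y, ⟪b j y, Torus.laplacian (b k) y⟫_ℝ))), ?_, fun u hu => ?_⟩
  · refine IsHomogeneous.sum _ _ 2 fun j _ => IsHomogeneous.sum _ _ 2 fun k _ => ?_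
    simpa using (isHomogeneous_X ℝ j).mul ((isHomogeneous_X ℝ k).mul (isHomogeneous_C (Fin n)
      (-(∫ y, ⟪b j y, Torus.laplacian (b k) y⟫_ℝ))))
  · rw [toReal_eGradNormSq_eq_of_level hb hbs u hu]
    simp only [map_sum, map_mul, eval_X, eval_C, mul_neg, Finset.sum_neg_distrib]

/-! ## The budgets of a level-`N`-carried law -/

/-- **Mean energy in coordinates**: `ensembleEnergy μ = ∫ Σᵢ (u, bᵢ)² dμ` for a law carried by
level-`N` fields. [folklore] -/
theorem ensembleEnergy_eq_integral_sum_sq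
    (hb : ∀ i, Torus.IsSmooth (b i) ∧ Torus.IsDivFree (b i) ∧ Torus.HasZeroMean (b i) ∧
      ∀ k ∉ (Torus.freqBall N).erase (0 : Fin 3 → ℤ),
        UnitAddTorus.mFourierCoeff (EuclideanSpace.complexify ∘ (b i)) k = 0)
    (hbo : ∀ i j, ∫ x, ⟪b i x, b j x⟫_ℝ = if i = j then (1 : ℝ) else 0)
    (hbs : ∀ u : Torus.energySpace (Fin 3),
      (∀ k ∉ (Torus.freqBall N).erase (0 : Fin 3 → ℤ),
        UnitAddTorus.mFourierCoeff (EuclideanSpace.complexify ∘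
          (u.1 : UnitAddTorus (Fin 3) → EuclideanSpace ℝ (Fin 3))) k = 0) →
      ∀ x, Torus.fourierTruncate N (u.1 : UnitAddTorus (Fin 3) → EuclideanSpace ℝ (Fin 3)) x =
        ∑ i, Torus.pairing u.1 (b i) • b i x)
    {μ : Measure (Torus.energySpace (Fin 3))}
    (hlev : ∀ᵐ u ∂μ, ∀ k ∉ (Torus.freqBall N).erase (0 : Fin 3 → ℤ),
      UnitAddTorus.mFourierCoeff (EuclideanSpace.complexify ∘
        (u.1 : UnitAddTorus (Fin 3) → EuclideanSpace ℝ (Fin 3))) k = 0) :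
    Torus.ensembleEnergy μ = ∫ u, ∑ i, (Torus.pairing u.1 (b i)) ^ 2 ∂μ := by
  unfold Torus.ensembleEnergy
  refine integral_congr_ae ?_
  filter_upwards [hlev] with u hu
  exact norm_sq_eq_sum_sq_coords hb hbo hbs u hu

/-- **Mean dissipation in coordinates**: if `‖∇u‖² = D(x)` on level-`N` fields then
`ensembleDissipation ν μ = ν ∫ D(x) dμ` for a law carried by level-`N` fields (the mean enstrophy is
a genuine integral since `‖∇u‖² < ∞` on level-`N` fields). [folklore] -/
theorem ensembleDissipation_eq_integral_eval {D : MvPolynomial (Fin n) ℝ}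
    (hD : ∀ u : Torus.energySpace (Fin 3), (∀ k ∉ (Torus.freqBall N).erase (0 : Fin 3 → ℤ),
        UnitAddTorus.mFourierCoeff (EuclideanSpace.complexify ∘
          (u.1 : UnitAddTorus (Fin 3) → EuclideanSpace ℝ (Fin 3))) k = 0) →
      (Torus.eGradNormSq (u.1 : UnitAddTorus (Fin 3) → EuclideanSpace ℝ (Fin 3))).toReal =
        MvPolynomial.eval (fun i => Torus.pairing u.1 (b i)) D)
    (ν : ℝ) {μ : Measure (Torus.energySpace (Fin 3))}
    (hlev : ∀ᵐ u ∂μ, ∀ k ∉ (Torus.freqBall N).erase (0 : Fin 3 → ℤ),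
      UnitAddTorus.mFourierCoeff (EuclideanSpace.complexify ∘
        (u.1 : UnitAddTorus (Fin 3) → EuclideanSpace ℝ (Fin 3))) k = 0) :
    Torus.ensembleDissipation ν μ =
      ν * ∫ u, MvPolynomial.eval (fun i => Torus.pairing u.1 (b i)) D ∂μ := by
  unfold Torus.ensembleDissipation Torus.ensembleEnstrophy
  congr 1
  rw [← integral_toReal Torus.measurable_eGradNormSq_coe.aemeasurable
    (hlev.mono fun u hu => CubicParityLoud.Negative.eGradNormSq_lt_top_of_isLevel hu)]
  refine integral_congr_ae ?_
  filter_upwards [hlev] with u hu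
  exact hD u hu

end Summit.AnomalousDissipation.AnomalousDissipation.Theorems.MomentParityQuarticGate
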